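import Mathlib
import Literature.NumberTheory.Transcendental.BrumerPadicSetup
import Literature.NumberTheory.Transcendental.PadicLiouvilleInequality
import HarnessLib

/-!
# Brumer's `p`-adic analogue of Baker's theorem — the number field of the set-up

Topic `Literature/NumberTheory/Transcendental`; namespace
`Literature.NumberTheory.Transcendental.BrumerPadic`.  Third support file for the proof of the
named fact `Literature.NumberTheory.Transcendental.brumer1967_thm1` (`BrumerPadicBaker.lean`;
A. Brumer, Mathematika **14** (1967), Theorem 1); sequel to `BrumerPadicSetup.lean` (the auxiliary
function `F c m` of a `Setup`).  It ports the tree's `BakerLogarithmsField.lean` (A. Baker,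
*Transcendental Number Theory*, 1975, Ch. 2, Lemma 2, p. 21, and Lemma 3, pp. 22–23) to the
`p`-adic set-up; the one genuinely `p`-adic ingredient is the **Liouville inequality at a `p`-adic
place** replacing "the norm of `f'` has absolute value at least `1`" (p. 23).

For a `Setup` `S` over `𝕂` we introduce the number field `K = ℚ(α₀, …, αₙ, β₀, …, β_{n-1}) ⊆ 𝕂`
(`Setup.K`, a `NumberField`), a common denominator `D` of the generators, a bound `M` for all
complex conjugates of the generators, an integral basis `bO` of `𝓞 K` indexed by the embeddings
`K →+* ℂ` and the constant `c_K` bounding integral coordinates by the house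
(Mathlib's `NumberField.house.basis_repr_norm_le_const_mul_house`) — all verbatim from the complex
file, the field now sitting in `𝕂` instead of `ℂ` (sizes are measured through the abstract
embeddings `K →+* ℂ`).

Main results (all proved):
* `norm_le_one_of_isIntegral'`, `liouville_padic` — in an ultrametric normed `ℚ_p`-algebra field,
  algebraic integers have norm `≤ 1`, and a non-zero algebraic integer `x` of a number field `K`
  embedded by `ι : K →+* 𝕂` satisfies `‖ι x‖ ≥ (C_h · max(1, house x)^h)⁻¹`, `h = [K:ℚ]`,
  `C_h = binom(h, h/2)` (the constant coefficient of the minimal polynomial of `x` is a non-zero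
  integer of absolute value `≤ C_h max(1, house x)^h`, Mathlib `Embeddings.coeff_bdd_of_norm_le`, and
  it equals `-x · g(x)` with `g` integral);
* `Setup.F_natMul_eq`: `F c m (l p) = P_m · G` with `G = ∑ c(λ) termK ∈ K`
  (`termK = ∏ᵣ γᵣ^{mᵣ} ∏ᵢ αᵢ^{λᵢ l}`), `Setup.isIntegral_D_pow_mul_termK`: `D^e termK ∈ 𝓞 K`,
  `e = |m| + (n+1) L l`, and `Setup.house_D_pow_mul_termK_le`;
* `Setup.norm_G_ge` — **Lemma 3, second assertion, `p`-adic form**: if `G ≠ 0` then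
  `‖G‖_𝕂 ≥ (C_h (max 1 H)^h)⁻¹` with the explicit house bound
  `H = (L+1)^{n+1} B |D|^e (2LM)^{|m|} M^{(n+1)Ll}` (`|c(λ)| ≤ B`);
* `Setup.lemma2` — **Lemma 2** (Siegel's lemma, Mathlib `Int.Matrix.exists_ne_zero_int_vec_norm_le`):
  if `2 P₀ (D₀+1)ⁿ h ≤ (L+1)^{n+1}` there are integers `c(λ)`, not all zero, explicitly bounded, with
  `F c m (l p) = 0` for `1 ≤ l ≤ P₀` and all `mᵣ ≤ D₀`.

## References

* [Brumer1967] A. Brumer, *On the units of algebraic number fields*, Mathematika 14 (1967),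
  121–124, Theorem 1.
* [BakerTNT1975] A. Baker, *Transcendental Number Theory*, CUP 1975, Ch. 2, Lemma 2 (p. 21),
  Lemma 3 (pp. 22–23).
* M. Waldschmidt, *Diophantine Approximation on Linear Algebraic Groups*, Springer 2000, §3.5
  (Liouville's inequality at an arbitrary place).
-/

noncomputable section

open NormedSpace Finset NumberField Polynomial

namespace Literature.NumberTheory.Transcendental

namespace BrumerPadic

variable {p : ℕ} [Fact p.Prime]

/-! ### Algebraic integers in an ultrametric `ℚ_p`-algebra and the `p`-adic Liouville inequality -/

section Liouville

variable {𝕂 : Type*} [NormedField 𝕂] [CharZero 𝕂] [instA : NormedAlgebra ℚ_[p] 𝕂]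
  [IsUltrametricDist 𝕂]
include instA

omit [CharZero 𝕂] [IsUltrametricDist 𝕂] in
/-- `‖z‖ ≤ 1` for an integer `z` in a normed `ℚ_p`-algebra. [folklore] -/
theorem norm_intCast_le_one' (z : ℤ) : ‖(z : 𝕂)‖ ≤ 1 := by
  rw [← map_intCast (algebraMap ℚ_[p] 𝕂) z, norm_algebraMap']
  obtain ⟨n, rfl | rfl⟩ := z.eq_nat_or_neg
  · rw [Int.cast_natCast]; exact EllipticCurves.norm_natCast_le_one n
  · rw [Int.cast_neg, Int.cast_natCast, norm_neg]; exact EllipticCurves.norm_natCast_le_one n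

omit [CharZero 𝕂] [IsUltrametricDist 𝕂] in
/-- `‖z‖ ≥ 1/|z|` for a non-zero integer `z` in a normed `ℚ_p`-algebra (`p^{v_p(z)} ≤ |z|`).
[folklore] -/
theorem inv_abs_le_norm_intCast {z : ℤ} (hz : z ≠ 0) : (|(z : ℝ)|)⁻¹ ≤ ‖(z : 𝕂)‖ := by
  rw [← map_intCast (algebraMap ℚ_[p] 𝕂) z, norm_algebraMap']
  have hn : z.natAbs ≠ 0 := Int.natAbs_ne_zero.mpr hz
  have h1 := inv_natCast_le_norm_natCast (p := p) hn
  have h2 : ‖(z : ℚ_[p])‖ = ‖((z.natAbs : ℕ) : ℚ_[p])‖ := by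
    rcases Int.natAbs_eq z with h | h
    · conv_lhs => rw [h]
      rw [Int.cast_natCast]
    · conv_lhs => rw [h]
      rw [Int.cast_neg, Int.cast_natCast, norm_neg]
  have h3 : |(z : ℝ)| = (z.natAbs : ℝ) := by
    rw [← Int.cast_abs, Int.abs_eq_natAbs, Int.cast_natCast]
  rw [h2, h3]
  exact h1

omit [CharZero 𝕂] in
/-- **Algebraic integers are `p`-adic integers**: an element of an ultrametric normed
`ℚ_p`-algebra field which is integral over `ℤ` has norm `≤ 1` (if `‖y‖ > 1` the leading term of a
monic integer relation dominates all others). [folklore] -/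
theorem norm_le_one_of_isIntegral' {y : 𝕂} (hy : IsIntegral ℤ y) : ‖y‖ ≤ 1 := by
  obtain ⟨f, hf, hfy⟩ := hy
  by_contra hgt
  push Not at hgt
  have hy0 : 0 < ‖y‖ := zero_lt_one.trans hgt
  set d := f.natDegree with hd
  -- `y^d = -∑_{i<d} aᵢ yⁱ`
  have hsum : ∑ i ∈ range (d + 1), ((f.coeff i : ℤ) : 𝕂) * y ^ i = 0 := by
    rw [Polynomial.eval₂_eq_sum_range] at hfy
    simpa using hfy
  rw [Finset.sum_range_succ] at hsum
  have hlead : f.coeff d = 1 := hf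
  rw [hlead, Int.cast_one, one_mul] at hsum
  have h1 : y ^ d = -∑ i ∈ range d, ((f.coeff i : ℤ) : 𝕂) * y ^ i := by
    linear_combination hsum
  -- degree `0` is impossible
  rcases Nat.eq_zero_or_pos d with hd0 | hdpos
  · rw [hd0] at h1
    simp at h1
  -- norms
  have h2 : ‖y ^ d‖ ≤ ‖y‖ ^ (d - 1) := by
    rw [h1, norm_neg]
    refine IsUltrametricDist.norm_sum_le_of_forall_le_of_nonneg (by positivity) fun i hi => ?_
    have hid : i ≤ d - 1 := by have := mem_range.mp hi; omega
    rw [norm_mul, norm_pow]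
    calc ‖((f.coeff i : ℤ) : 𝕂)‖ * ‖y‖ ^ i ≤ 1 * ‖y‖ ^ (d - 1) := by
          refine mul_le_mul (norm_intCast_le_one' (p := p) _)
            (pow_le_pow_right₀ hgt.le hid) (by positivity) zero_le_one
      _ = ‖y‖ ^ (d - 1) := one_mul _
  rw [norm_pow] at h2
  have h3 : ‖y‖ ^ (d - 1) < ‖y‖ ^ d := pow_lt_pow_right₀ hgt (by omega)
  exact absurd h2 (not_le.mpr h3)

omit [CharZero 𝕂] in
/-- The value of an integer-coefficient polynomial at a `p`-adic integer has norm `≤ 1`.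
[folklore] -/
theorem norm_aeval_le_one_of_int {y : 𝕂} (hy : ‖y‖ ≤ 1) (g : ℤ[X]) :
    ‖aeval y g‖ ≤ 1 := by
  rw [Polynomial.aeval_eq_sum_range]
  refine IsUltrametricDist.norm_sum_le_of_forall_le_of_nonneg zero_le_one fun i _ => ?_
  rw [zsmul_eq_mul, norm_mul, norm_pow]
  exact mul_le_one₀ (norm_intCast_le_one' (p := p) _) (by positivity)
    (pow_le_one₀ (norm_nonneg _) hy)

variable {K : Type*} [Field K] [NumberField K]

/-- **The `p`-adic Liouville inequality for algebraic integers.**  Let `K` be a number field,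
`ι : K →+* 𝕂` a ring homomorphism into an ultrametric normed `ℚ_p`-algebra field, and `x ∈ K` a
non-zero algebraic integer.  Then `‖ι x‖ ≥ (C_h · max(1, house x)^h)⁻¹` with `h = [K : ℚ]` and
`C_h = binom(h, ⌊h/2⌋)`.  Proof: the minimal polynomial `f` of `x` over `ℚ` has integer
coefficients, constant coefficient `a₀ ≠ 0` with `|a₀| ≤ C_h max(1, house x)^h`
(Mathlib `NumberField.Embeddings.coeff_bdd_of_norm_le`, the complex roots of `f` being conjugates of
`x`), and `a₀ = -(f/X)(ι x) · ι x` with `‖(f/X)(ι x)‖ ≤ 1`; so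
`‖ι x‖ ≥ ‖a₀‖_p ≥ 1/|a₀|`. [folklore] -/
theorem liouville_padic (ι : K →+* 𝕂) {x : K} (hx : x ≠ 0) (hint : IsIntegral ℤ x) :
    (((Module.finrank ℚ K).choose (Module.finrank ℚ K / 2) : ℝ) *
      max 1 (house x) ^ Module.finrank ℚ K)⁻¹ ≤ ‖ι x‖ := by
  set h := Module.finrank ℚ K with hh
  set f : ℚ[X] := minpoly ℚ x with hf
  set fZ : ℤ[X] := minpoly ℤ x with hfZ
  have hfeq : f = fZ.map (algebraMap ℤ ℚ) := minpoly.isIntegrallyClosed_eq_field_fractions' ℚ hint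
  -- the constant coefficient
  set z : ℤ := fZ.coeff 0 with hz
  have hfz : f.coeff 0 = (z : ℚ) := by rw [hfeq, Polynomial.coeff_map]; rfl
  have hz0 : z ≠ 0 := by
    intro h0
    have h1 := minpoly.coeff_zero_ne_zero (A := ℚ) (Algebra.IsIntegral.isIntegral x) hx
    rw [← hf, hfz, h0, Int.cast_zero] at h1
    exact h1 rfl
  -- its size
  have hbound : |(z : ℝ)| ≤ (h.choose (h / 2) : ℝ) * max 1 (house x) ^ h := by
    have hB : ∀ φ : K →+* ℂ, ‖φ x‖ ≤ house x := fun φ => NumberField.norm_embedding_le_house x φ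
    have h1 := NumberField.Embeddings.coeff_bdd_of_norm_le (K := K) (A := ℂ) hB 0
    rw [hfz] at h1
    have h2 : ‖((z : ℚ))‖ = |(z : ℝ)| := by
      rw [← Rat.norm_cast_real, Real.norm_eq_abs, Rat.cast_intCast]
    rw [h2, max_comm] at h1
    linarith [h1]
  -- the identity `ι x · (f/X)(ι x) + z = 0` in `𝕂`
  have hιx1 : ‖ι x‖ ≤ 1 := norm_le_one_of_isIntegral' (p := p) (hint.map ι.toIntAlgHom)
  have haeval : aeval (ι x) f = 0 := by
    have h1 : aeval x f = 0 := minpoly.aeval ℚ x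
    have h2 := congrArg ι h1
    rw [map_zero] at h2
    rw [← h2, hf]
    exact (Polynomial.aeval_algHom_apply ι.toRatAlgHom x (minpoly ℚ x))
  have hsplit : f.divX * X + C (f.coeff 0) = f := Polynomial.divX_mul_X_add f
  have hdivX : f.divX = fZ.divX.map (algebraMap ℤ ℚ) := by
    rw [hfeq]
    ext i
    simp [Polynomial.coeff_divX, Polynomial.coeff_map]
  have hid : aeval (ι x) (fZ.divX.map (algebraMap ℤ ℚ)) * ι x + (z : 𝕂) = 0 := by
    have h1 := haeval
    rw [← hsplit, map_add, map_mul, aeval_X, aeval_C, hfz, hdivX] at h1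
    simpa using h1
  have hgint : ‖aeval (ι x) (fZ.divX.map (algebraMap ℤ ℚ))‖ ≤ 1 := by
    rw [Polynomial.aeval_map_algebraMap]
    exact norm_aeval_le_one_of_int (p := p) hιx1 _
  -- norms
  have hzle : ‖(z : 𝕂)‖ ≤ ‖ι x‖ := by
    have e : (z : 𝕂) = -(aeval (ι x) (fZ.divX.map (algebraMap ℤ ℚ)) * ι x) := by
      linear_combination hid
    rw [e, norm_neg, norm_mul]
    calc ‖aeval (ι x) (fZ.divX.map (algebraMap ℤ ℚ))‖ * ‖ι x‖ ≤ 1 * ‖ι x‖ :=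
          mul_le_mul_of_nonneg_right hgint (norm_nonneg _)
      _ = ‖ι x‖ := one_mul _
  have hzge : (|(z : ℝ)|)⁻¹ ≤ ‖(z : 𝕂)‖ := inv_abs_le_norm_intCast (p := p) hz0
  have hzpos : 0 < |(z : ℝ)| := abs_pos.mpr (by exact_mod_cast hz0)
  calc (((h.choose (h / 2) : ℝ)) * max 1 (house x) ^ h)⁻¹ ≤ (|(z : ℝ)|)⁻¹ :=
        inv_anti₀ hzpos hbound
    _ ≤ ‖(z : 𝕂)‖ := hzge
    _ ≤ ‖ι x‖ := hzle

end Liouville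

/-! ### The algebraic part of a term, evaluated at arbitrary conjugates -/

/-- The algebraic part of one term of `F c m (l p)` with the generators `αᵢ, βᵣ` replaced by
arbitrary complex numbers `aᵢ, bᵣ` (used for the conjugates; Baker 1975, p. 23):
`∏ᵣ (λᵣ + λₙ bᵣ)^{mᵣ} · ∏ᵢ aᵢ^{λᵢ l}`. [cite: BakerTNT1975, Ch. 2 Lemma 3] -/
def termEval (n L : ℕ) (a : Fin (n + 1) → ℂ) (b : Fin n → ℂ) (u : Idx n L) (m : Fin n → ℕ)
    (l : ℕ) : ℂ :=
  (∏ r : Fin n, ((((u (Fin.castSucc r)) : ℕ) : ℂ) + ((u (Fin.last n) : ℕ) : ℂ) * b r) ^ m r) *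
    ∏ i, a i ^ ((u i : ℕ) * l)

/-- **Size of the conjugates** (Baker 1975, p. 23: "any conjugate of `f'` … has absolute value at
most `c₁₀^{h²+Ll}`"): if `M ≥ 1` bounds `|aᵢ|, |bᵣ|` then `|termEval| ≤ (2LM)^{|m|} M^{(n+1)Ll}`.
[cite: BakerTNT1975, Ch. 2 Lemma 3] -/
theorem norm_termEval_le {n L : ℕ} {a : Fin (n + 1) → ℂ} {b : Fin n → ℂ} {M : ℝ}
    (hM : 1 ≤ M) (ha : ∀ i, ‖a i‖ ≤ M) (hb : ∀ r, ‖b r‖ ≤ M) (u : Idx n L)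
    (m : Fin n → ℕ) (l : ℕ) :
    ‖termEval n L a b u m l‖ ≤ (2 * L * M) ^ (∑ r, m r) * M ^ ((n + 1) * (L * l)) := by
  have hL0 : (0 : ℝ) ≤ L := Nat.cast_nonneg _
  have hlam : ∀ i, ((u i : ℕ) : ℝ) ≤ L := fun i => by exact_mod_cast Nat.lt_succ_iff.mp (u i).isLt
  -- the `γ` factor
  have hγ : ‖∏ r : Fin n, ((((u (Fin.castSucc r)) : ℕ) : ℂ) +
      ((u (Fin.last n) : ℕ) : ℂ) * b r) ^ m r‖ ≤ (2 * L * M) ^ (∑ r : Fin n, m r) := by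
    rw [norm_prod, ← prod_pow_eq_pow_sum]
    refine prod_le_prod (fun r _ => norm_nonneg _) fun r _ => ?_
    rw [norm_pow]
    refine pow_le_pow_left₀ (norm_nonneg _) ((norm_add_le _ _).trans ?_) _
    rw [norm_mul, Complex.norm_natCast, Complex.norm_natCast]
    have h1 : ((u (Fin.last n) : ℕ) : ℝ) * ‖b r‖ ≤ L * M :=
      mul_le_mul (hlam _) (hb r) (norm_nonneg _) hL0
    have h2 : ((u (Fin.castSucc r) : ℕ) : ℝ) ≤ L * M :=
      (hlam _).trans (le_mul_of_one_le_right hL0 hM)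
    linarith
  -- the `α` factor
  have hα : ‖∏ i, a i ^ ((u i : ℕ) * l)‖ ≤ M ^ ((n + 1) * (L * l)) := by
    rw [norm_prod]
    calc ∏ i, ‖a i ^ ((u i : ℕ) * l)‖ ≤ ∏ _i : Fin (n + 1), M ^ (L * l) := by
          refine prod_le_prod (fun i _ => norm_nonneg _) fun i _ => ?_
          rw [norm_pow]
          calc ‖a i‖ ^ ((u i : ℕ) * l) ≤ (max 1 ‖a i‖) ^ ((u i : ℕ) * l) :=
                pow_le_pow_left₀ (norm_nonneg _) (le_max_right _ _) _
            _ ≤ (max 1 ‖a i‖) ^ (L * l) :=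
                pow_le_pow_right₀ (le_max_left _ _)
                  (Nat.mul_le_mul_right _ (Nat.lt_succ_iff.mp (u i).isLt))
            _ ≤ M ^ (L * l) := pow_le_pow_left₀ (by positivity) (max_le hM (ha i)) _
      _ = M ^ ((n + 1) * (L * l)) := by
          rw [prod_const, card_univ, Fintype.card_fin, ← pow_mul, mul_comm]
  calc ‖termEval n L a b u m l‖
      = ‖∏ r : Fin n, ((((u (Fin.castSucc r)) : ℕ) : ℂ) +
            ((u (Fin.last n) : ℕ) : ℂ) * b r) ^ m r‖ * ‖∏ i, a i ^ ((u i : ℕ) * l)‖ := by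
        rw [termEval, norm_mul]
    _ ≤ (2 * L * M) ^ (∑ r, m r) * M ^ ((n + 1) * (L * l)) := by gcongr

namespace Setup

variable {𝕂 : Type*} [NontriviallyNormedField 𝕂] [CharZero 𝕂] [NormedAlgebra ℚ_[p] 𝕂]
variable (S : Setup p 𝕂) {L : ℕ}

/-! ### The number field `K = ℚ(α₀, …, αₙ, β₀, …, β_{n-1})` of the set-up -/

/-- The generators `α₀, …, αₙ, β₀, …, β_{n-1}` of the field of the set-up. [cite: BakerTNT1975, Ch. 2 §3] -/
def gens : Set 𝕂 := Set.range S.α ∪ Set.range S.β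

/-- The set of generators is finite. [folklore] -/
theorem gens_finite : S.gens.Finite :=
  (Set.finite_range _).union (Set.finite_range _)

/-- The generators are algebraic. [cite: BakerTNT1975, Ch. 2 §3] -/
theorem isAlgebraic_of_mem_gens {x : 𝕂} (hx : x ∈ S.gens) : IsAlgebraic ℚ x := by
  rcases hx with ⟨i, rfl⟩ | ⟨r, rfl⟩
  · exact S.isAlgebraic_exp i
  · exact S.isAlgebraic_β r

/-- The number field `K = ℚ(α₀, …, αₙ, β₀, …, β_{n-1}) ⊆ 𝕂` in which the algebraic parts of the
values `F c m (l p)` live (Baker 1975, p. 23: "an algebraic integer with degree at most `d^{2n}`").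
[cite: BakerTNT1975, Ch. 2 Lemma 3] -/
def K : IntermediateField ℚ 𝕂 := IntermediateField.adjoin ℚ S.gens

/-- `K/ℚ` is finite. [folklore] -/
instance finiteDimensional_K : FiniteDimensional ℚ S.K := by
  haveI : Finite S.gens := S.gens_finite.to_subtype
  exact IntermediateField.finiteDimensional_adjoin fun x hx =>
    (S.isAlgebraic_of_mem_gens hx).isIntegral

/-- `K` is a number field. [folklore] -/
instance numberField_K : NumberField S.K :=
  { to_charZero := charZero_of_injective_algebraMap (algebraMap ℚ S.K).injective
    to_finiteDimensional := S.finiteDimensional_K }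

/-- The generators lie in `K`. [folklore] -/
theorem mem_K_of_mem_gens {x : 𝕂} (hx : x ∈ S.gens) : x ∈ S.K :=
  IntermediateField.subset_adjoin _ _ hx

/-- `αᵢ` as an element of `K`. [cite: BakerTNT1975, Ch. 2 §3] -/
def αK (i : Fin (S.n + 1)) : S.K := ⟨S.α i, S.mem_K_of_mem_gens (Or.inl ⟨i, rfl⟩)⟩

/-- `βᵣ` as an element of `K`. [cite: BakerTNT1975, Ch. 2 §3] -/
def βK (r : Fin S.n) : S.K := ⟨S.β r, S.mem_K_of_mem_gens (Or.inr ⟨r, rfl⟩)⟩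

/-- `(αK i : 𝕂) = αᵢ`. [folklore] -/
@[simp] theorem coe_αK (i : Fin (S.n + 1)) : (S.αK i : 𝕂) = S.α i := rfl

/-- `(βK r : 𝕂) = βᵣ`. [folklore] -/
@[simp] theorem coe_βK (r : Fin S.n) : (S.βK r : 𝕂) = S.β r := rfl

/-- The family of all generators, in `K`, indexed by `Fin (n+1) ⊕ Fin n`
(`inl i ↦ αᵢ`, `inr r ↦ βᵣ`). [folklore] -/
def genK : Fin (S.n + 1) ⊕ Fin S.n → S.K
  | Sum.inl i => S.αK i
  | Sum.inr r => S.βK r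

/-- **A common denominator** (Baker's leading coefficients, p. 20): a non-zero integer `D` with
`D αᵢ`, `D βᵣ` algebraic integers. [cite: BakerTNT1975, Ch. 2 §3, eq. (2)] -/
theorem exists_den : ∃ D : ℤ, D ≠ 0 ∧ ∀ g, IsIntegral ℤ ((D : S.K) * S.genK g) := by
  have h1 : ∀ g, ∃ y : ℤ, y ≠ 0 ∧ IsIntegral ℤ ((y : S.K) * S.genK g) := by
    intro g
    have hQ : IsAlgebraic ℚ (S.genK g) := Algebra.IsAlgebraic.isAlgebraic _
    have hz : IsAlgebraic ℤ (S.genK g) := (IsFractionRing.isAlgebraic_iff ℤ ℚ S.K).mpr hQ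
    obtain ⟨y, hy, hint⟩ := hz.exists_integral_multiple
    exact ⟨y, hy, by simpa [zsmul_eq_mul] using hint⟩
  choose y hy hint using h1
  classical
  refine ⟨∏ g, y g, prod_ne_zero_iff.mpr fun g _ => hy g, fun g => ?_⟩
  rw [← mul_prod_erase univ y (mem_univ g)]
  push_cast
  rw [mul_comm ((y g : S.K)) _, mul_assoc]
  have h2 : IsIntegral ℤ (((∏ j ∈ univ.erase g, y j : ℤ) : S.K)) := by
    exact_mod_cast isIntegral_algebraMap (R := ℤ) (A := S.K) (x := ∏ j ∈ univ.erase g, y j)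
  simpa using h2.mul (hint g)

/-- The common denominator `D ≠ 0` of the generators. [cite: BakerTNT1975, Ch. 2 §3, eq. (2)] -/
def D : ℤ := S.exists_den.choose

/-- `D ≠ 0`. [folklore] -/
theorem D_ne_zero : S.D ≠ 0 := S.exists_den.choose_spec.1

/-- `D · g` is an algebraic integer for every generator `g`. [folklore] -/
theorem isIntegral_D_mul_genK (g : Fin (S.n + 1) ⊕ Fin S.n) :
    IsIntegral ℤ ((S.D : S.K) * S.genK g) :=
  S.exists_den.choose_spec.2 g

/-- `D αᵢ` is an algebraic integer. [folklore] -/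
theorem isIntegral_D_mul_αK (i : Fin (S.n + 1)) : IsIntegral ℤ ((S.D : S.K) * S.αK i) :=
  S.isIntegral_D_mul_genK (Sum.inl i)

/-- `D βᵣ` is an algebraic integer. [folklore] -/
theorem isIntegral_D_mul_βK (r : Fin S.n) : IsIntegral ℤ ((S.D : S.K) * S.βK r) :=
  S.isIntegral_D_mul_genK (Sum.inr r)

/-- `1 ≤ |D|`. [folklore] -/
theorem one_le_abs_D : (1 : ℝ) ≤ |(S.D : ℝ)| := by exact_mod_cast Int.one_le_abs S.D_ne_zero

/-- **A bound for the conjugates of the generators**: `M = 1 + ∑_σ ∑_g |σ g| ≥ 1`.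
[cite: BakerTNT1975, Ch. 2 Lemma 3] -/
def M : ℝ := 1 + ∑ σ : S.K →+* ℂ, ∑ g, ‖σ (S.genK g)‖

/-- `1 ≤ M`. [folklore] -/
theorem one_le_M : 1 ≤ S.M := by
  have : 0 ≤ ∑ σ : S.K →+* ℂ, ∑ g, ‖σ (S.genK g)‖ := by positivity
  unfold M; linarith

/-- Every conjugate of every generator has absolute value at most `M`. [folklore] -/
theorem norm_embedding_genK_le (σ : S.K →+* ℂ) (g : Fin (S.n + 1) ⊕ Fin S.n) :
    ‖σ (S.genK g)‖ ≤ S.M := by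
  have h1 : ‖σ (S.genK g)‖ ≤ ∑ g', ‖σ (S.genK g')‖ :=
    single_le_sum (f := fun g' => ‖σ (S.genK g')‖) (fun _ _ => norm_nonneg _) (mem_univ g)
  have h2 : ∑ g', ‖σ (S.genK g')‖ ≤ ∑ τ : S.K →+* ℂ, ∑ g', ‖τ (S.genK g')‖ :=
    single_le_sum (f := fun τ : S.K →+* ℂ => ∑ g', ‖τ (S.genK g')‖) (fun _ _ => by positivity)
      (mem_univ σ)
  unfold M; linarith

/-- `|σ αᵢ| ≤ M`. [folklore] -/
theorem norm_embedding_αK_le (σ : S.K →+* ℂ) (i : Fin (S.n + 1)) : ‖σ (S.αK i)‖ ≤ S.M :=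
  S.norm_embedding_genK_le σ (Sum.inl i)

/-- `|σ βᵣ| ≤ M`. [folklore] -/
theorem norm_embedding_βK_le (σ : S.K →+* ℂ) (r : Fin S.n) : ‖σ (S.βK r)‖ ≤ S.M :=
  S.norm_embedding_genK_le σ (Sum.inr r)

/-- The number of complex embeddings of `K` (`= [K : ℚ]`). [cite: BakerTNT1975, Ch. 2 Lemma 3] -/
def h : ℕ := Fintype.card (S.K →+* ℂ)

/-- `h = [K : ℚ]`. [folklore] -/
theorem h_eq_finrank : S.h = Module.finrank ℚ S.K := Embeddings.card S.K ℂ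

/-- `1 ≤ h`. [folklore] -/
theorem one_le_h : 1 ≤ S.h := Fintype.card_pos

/-! ### Integer coordinates in an integral basis -/

/-- An integral basis of `𝓞 K`, indexed by the embeddings `K → ℂ` (Mathlib's
`RingOfIntegers.basis` reindexed by `equivReindex`). [folklore] -/
def bO : Module.Basis (S.K →+* ℂ) ℤ (𝓞 S.K) :=
  (RingOfIntegers.basis S.K).reindex (equivReindex S.K).symm

/-- **Coordinates are bounded by the house**: there is `c_K ≥ 1` with
`|coordᵢ(x)| ≤ c_K · house(x)` for every algebraic integer `x` of `K` (Mathlib's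
`NumberField.house.basis_repr_norm_le_const_mul_house`). [folklore] -/
theorem exists_cK : ∃ C : ℝ, 1 ≤ C ∧ ∀ (x : 𝓞 S.K) (i : S.K →+* ℂ),
    |((S.bO.repr x i : ℤ) : ℝ)| ≤ C * house (algebraMap (𝓞 S.K) S.K x) := by
  classical
  obtain ⟨C, hC⟩ : ∃ C : ℝ, ∀ (x : 𝓞 S.K) (i : S.K →+* ℂ),
      ‖((((integralBasis S.K).reindex (equivReindex S.K).symm).repr x i : ℚ) : ℂ)‖ ≤
        C * house (algebraMap (𝓞 S.K) S.K x) :=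
    ⟨_, NumberField.house.basis_repr_norm_le_const_mul_house S.K⟩
  refine ⟨max 1 C, le_max_left _ _, fun x i => ?_⟩
  have h1 := hC x i
  have h2 : ((((integralBasis S.K).reindex (equivReindex S.K).symm).repr x i : ℚ) : ℂ) =
      ((S.bO.repr x i : ℤ) : ℂ) := by
    simp [bO, Module.Basis.repr_reindex, integralBasis_repr_apply]
  rw [h2, Complex.norm_intCast] at h1
  exact h1.trans (mul_le_mul_of_nonneg_right (le_max_right _ _) (house_nonneg _))

/-- The constant `c_K ≥ 1` of `exists_cK`. [folklore] -/
def cK : ℝ := S.exists_cK.choose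

/-- `1 ≤ c_K`. [folklore] -/
theorem one_le_cK : 1 ≤ S.cK := S.exists_cK.choose_spec.1

/-- `|coordᵢ(x)| ≤ c_K house(x)`. [folklore] -/
theorem abs_repr_le (x : 𝓞 S.K) (i : S.K →+* ℂ) :
    |((S.bO.repr x i : ℤ) : ℝ)| ≤ S.cK * house (algebraMap (𝓞 S.K) S.K x) :=
  S.exists_cK.choose_spec.2 x i

/-- `house x ≤ B` from a bound on all conjugates. [folklore] -/
theorem house_le_of_forall_norm_le {x : S.K} {B : ℝ} (hB : 0 ≤ B)
    (h : ∀ σ : S.K →+* ℂ, ‖σ x‖ ≤ B) : house x ≤ B := by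
  rw [house, pi_norm_le_iff_of_nonneg hB]
  intro σ
  exact h σ

/-! ### Integrality helpers -/

/-- Natural numbers are algebraic integers. [folklore] -/
theorem isIntegral_natCast_K (k : ℕ) : IsIntegral ℤ (k : S.K) := by
  exact_mod_cast isIntegral_algebraMap (R := ℤ) (A := S.K) (x := (k : ℤ))

/-- Integers are algebraic integers. [folklore] -/
theorem isIntegral_intCast_K (k : ℤ) : IsIntegral ℤ (k : S.K) := by
  exact_mod_cast isIntegral_algebraMap (R := ℤ) (A := S.K) (x := k)

/-! ### The algebraic part of `F c m (l p)` -/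

variable (L) in
/-- The algebraic part of one term of `F c m (l p)` as an element of `K`:
`∏ᵣ γᵣ^{mᵣ} ∏ᵢ αᵢ^{λᵢ l}` (so that the term is `P_m · c(λ) · termK`, cf. Baker's
`f(l) = P ∑ p(λ) α₁^{λ₁l} ⋯ αₙ^{λₙl} γ₁^{m₁} ⋯`, p. 22). [cite: BakerTNT1975, Ch. 2 Lemma 3] -/
def termK (u : Idx S.n L) (m : Fin S.n → ℕ) (l : ℕ) : S.K :=
  (∏ r : Fin S.n, ((((u (Fin.castSucc r)) : ℕ) : S.K) +
      ((u (Fin.last S.n) : ℕ) : S.K) * S.βK r) ^ m r) *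
    ∏ i, S.αK i ^ ((u i : ℕ) * l)

/-- Conjugates of `termK` are `termEval` at the conjugates of the generators. [folklore] -/
theorem map_termK (σ : S.K →+* ℂ) (u : Idx S.n L) (m : Fin S.n → ℕ) (l : ℕ) :
    σ (S.termK L u m l) = termEval S.n L (fun i => σ (S.αK i)) (fun r => σ (S.βK r)) u m l := by
  simp only [termK, termEval, map_mul, map_prod, map_pow, map_add, map_natCast]

/-- In `𝕂`, `termK` is `∏ᵣ γᵣ^{mᵣ} ∏ᵢ αᵢ^{λᵢ l}`. [folklore] -/
theorem algebraMap_termK (u : Idx S.n L) (m : Fin S.n → ℕ) (l : ℕ) :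
    algebraMap S.K 𝕂 (S.termK L u m l) = (∏ r, S.γ u r ^ m r) * ∏ i, S.α i ^ ((u i : ℕ) * l) := by
  simp only [termK, map_mul, map_prod, map_pow, map_add, map_natCast, γ]
  rfl

variable (L) in
/-- The algebraic number `G = ∑_λ c(λ) termK` with `F c m (l p) = P_m G` (Baker's `f(l)/P`).
[cite: BakerTNT1975, Ch. 2 Lemma 3] -/
def G (c : Idx S.n L → ℤ) (m : Fin S.n → ℕ) (l : ℕ) : S.K :=
  ∑ u, (c u : S.K) * S.termK L u m l

/-- **`F c m (l p) = P_m · G`**. [cite: BakerTNT1975, Ch. 2 Lemma 3] -/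
theorem F_natMul_eq [IsUltrametricDist 𝕂] [CompleteSpace 𝕂] (c : Idx S.n L → ℤ)
    (m : Fin S.n → ℕ) (l : ℕ) :
    S.F c m ((l : 𝕂) * p) = S.P m * algebraMap S.K 𝕂 (S.G L c m l) := by
  rw [S.F_natMul, G, map_sum]
  congr 1
  refine sum_congr rfl fun u _ => ?_
  rw [map_mul, map_intCast, S.algebraMap_termK]

/-- The exponent of the denominator: `e = |m| + (n+1) L l` (Baker's `P' = (a₁⋯aₙ)^{Ll} ⋯`,
eq. (6), p. 21). [cite: BakerTNT1975, Ch. 2 Lemma 2, eq. (6)] -/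
def eD (n L : ℕ) (m : Fin n → ℕ) (l : ℕ) : ℕ := (∑ r, m r) + (n + 1) * (L * l)

/-- **Clearing denominators**: `D^e · termK` is an algebraic integer (Baker 1975, p. 23: "`f'` is
an algebraic integer"). [cite: BakerTNT1975, Ch. 2 Lemma 3] -/
theorem isIntegral_D_pow_mul_termK (u : Idx S.n L) (m : Fin S.n → ℕ) (l : ℕ) :
    IsIntegral ℤ ((S.D : S.K) ^ eD S.n L m l * S.termK L u m l) := by
  have h2 : ∀ r : Fin S.n, IsIntegral ℤ ((S.D : S.K) ^ m r *
      ((((u (Fin.castSucc r)) : ℕ) : S.K) + ((u (Fin.last S.n) : ℕ) : S.K) * S.βK r) ^ m r) := by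
    intro r
    rw [← mul_pow, mul_add, mul_left_comm]
    exact (((S.isIntegral_intCast_K _).mul (S.isIntegral_natCast_K _)).add
      ((S.isIntegral_natCast_K _).mul (S.isIntegral_D_mul_βK r))).pow _
  have h3 : ∀ i, IsIntegral ℤ ((S.D : S.K) ^ (L * l) * S.αK i ^ ((u i : ℕ) * l)) := by
    intro i
    have hv : (u i : ℕ) ≤ L := Nat.lt_succ_iff.mp (u i).isLt
    have e : L * l = (L - (u i : ℕ)) * l + (u i : ℕ) * l := by
      rw [← add_mul, Nat.sub_add_cancel hv]
    rw [e, pow_add, mul_assoc, ← mul_pow]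
    exact ((S.isIntegral_intCast_K _).pow _).mul ((S.isIntegral_D_mul_αK i).pow _)
  have e : (S.D : S.K) ^ eD S.n L m l * S.termK L u m l =
      (∏ r : Fin S.n, (S.D : S.K) ^ m r *
        ((((u (Fin.castSucc r)) : ℕ) : S.K) + ((u (Fin.last S.n) : ℕ) : S.K) * S.βK r) ^ m r) *
      ∏ i, (S.D : S.K) ^ (L * l) * S.αK i ^ ((u i : ℕ) * l) := by
    rw [prod_mul_distrib, prod_mul_distrib, prod_pow_eq_pow_sum, prod_const, card_univ,
      Fintype.card_fin, ← pow_mul, eD, pow_add, termK]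
    ring
  rw [e]
  exact (IsIntegral.prod _ fun r _ => h2 r).mul (IsIntegral.prod _ fun i _ => h3 i)

/-- **Size of the conjugates of `D^e termK`**: `house(D^e termK) ≤ |D|^e (2LM)^{|m|} M^{(n+1)Ll}`
(Baker 1975, p. 23). [cite: BakerTNT1975, Ch. 2 Lemma 3] -/
theorem house_D_pow_mul_termK_le (e : ℕ) (u : Idx S.n L) (m : Fin S.n → ℕ) (l : ℕ) :
    house ((S.D : S.K) ^ e * S.termK L u m l) ≤
      |(S.D : ℝ)| ^ e * ((2 * L * S.M) ^ (∑ r, m r) * S.M ^ ((S.n + 1) * (L * l))) := by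
  have hM0 : (0 : ℝ) < S.M := lt_of_lt_of_le one_pos S.one_le_M
  refine S.house_le_of_forall_norm_le (by positivity) fun σ => ?_
  rw [map_mul, map_pow, map_intCast, norm_mul, norm_pow, Complex.norm_intCast, S.map_termK]
  exact mul_le_mul_of_nonneg_left (norm_termEval_le S.one_le_M (S.norm_embedding_αK_le σ)
    (S.norm_embedding_βK_le σ) u m l) (by positivity)

/-! ### Lemma 3, second assertion: the `p`-adic arithmetic lower bound -/

/-- The Liouville constant `C_h = binom(h, ⌊h/2⌋) ≥ 1` of the field `K`. [folklore] -/
def Ch : ℝ := ((S.h.choose (S.h / 2) : ℕ) : ℝ)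

/-- `1 ≤ C_h`. [folklore] -/
theorem one_le_Ch : 1 ≤ S.Ch := by
  unfold Ch
  exact_mod_cast Nat.choose_pos (Nat.div_le_self _ _)

variable [IsUltrametricDist 𝕂]

omit [IsUltrametricDist 𝕂] in
/-- `‖D‖_𝕂 ≤ 1`. [folklore] -/
theorem norm_D_le_one : ‖((S.D : 𝕂))‖ ≤ 1 := norm_intCast_le_one' (p := p) S.D

/-- **Baker 1975, Lemma 3, second assertion, `p`-adic form.**  If the algebraic number
`G = ∑ c(λ) termK` is non-zero and `|c(λ)| ≤ B`, then
`‖G‖_𝕂 ≥ (C_h · (max 1 H)^h)⁻¹`, `H = (L+1)^{n+1} B |D|^e (2LM)^{|m|} M^{(n+1)Ll}`, `h = [K:ℚ]`: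
the algebraic integer `X = D^e G` has house `≤ H`, so by the `p`-adic Liouville inequality
`‖X‖_𝕂 ≥ (C_h max(1,H)^h)⁻¹`, and `‖X‖_𝕂 ≤ ‖G‖_𝕂` since `‖D‖_𝕂 ≤ 1`.  (The source's complex
argument: the norm of `f'` is a non-zero rational integer.) [cite: BakerTNT1975, Ch. 2 Lemma 3] -/
theorem norm_G_ge (c : Idx S.n L → ℤ) {B : ℝ} (hB : ∀ u, |(c u : ℝ)| ≤ B)
    (m : Fin S.n → ℕ) (l : ℕ) (hne : S.G L c m l ≠ 0) :
    (S.Ch * (max 1 (((L + 1 : ℕ) : ℝ) ^ (S.n + 1) * B * (|(S.D : ℝ)| ^ eD S.n L m l *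
        ((2 * L * S.M) ^ (∑ r, m r) * S.M ^ ((S.n + 1) * (L * l)))))) ^ S.h)⁻¹ ≤
      ‖algebraMap S.K 𝕂 (S.G L c m l)‖ := by
  have hB0 : 0 ≤ B := (abs_nonneg _).trans (hB default)
  set e := eD S.n L m l with he
  -- the algebraic integer `X = D^e G`
  have hXint : IsIntegral ℤ ((S.D : S.K) ^ e * S.G L c m l) := by
    unfold G
    rw [mul_sum]
    refine IsIntegral.sum _ fun u _ => ?_
    rw [mul_left_comm]
    exact (S.isIntegral_intCast_K _).mul (S.isIntegral_D_pow_mul_termK u m l)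
  have hX0 : (S.D : S.K) ^ e * S.G L c m l ≠ 0 :=
    mul_ne_zero (pow_ne_zero _ (by exact_mod_cast S.D_ne_zero)) hne
  -- its house
  have hhouse : house ((S.D : S.K) ^ e * S.G L c m l) ≤ ((L + 1 : ℕ) : ℝ) ^ (S.n + 1) * B *
      (|(S.D : ℝ)| ^ e * ((2 * L * S.M) ^ (∑ r, m r) * S.M ^ ((S.n + 1) * (L * l)))) := by
    have hXK : (S.D : S.K) ^ e * S.G L c m l =
        ∑ u, (c u : S.K) * ((S.D : S.K) ^ e * S.termK L u m l) := by
      simp only [G, mul_sum]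
      exact sum_congr rfl fun u _ => by ring
    rw [hXK]
    calc house (∑ u, (c u : S.K) * ((S.D : S.K) ^ e * S.termK L u m l))
        ≤ ∑ u, house ((c u : S.K) * ((S.D : S.K) ^ e * S.termK L u m l)) :=
          house_sum_le_sum_house _ _
      _ ≤ ∑ _u : Idx S.n L, B * (|(S.D : ℝ)| ^ e *
          ((2 * L * S.M) ^ (∑ r, m r) * S.M ^ ((S.n + 1) * (L * l)))) := by
          refine sum_le_sum fun u _ => (house_mul_le _ _).trans ?_
          rw [house_intCast]
          push_cast
          exact mul_le_mul (hB u) (S.house_D_pow_mul_termK_le e u m l) (house_nonneg _) hB0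
      _ = _ := by
          rw [sum_const, card_univ, card_Idx, nsmul_eq_mul]; push_cast; ring
  -- the `p`-adic Liouville inequality
  have hmain := liouville_padic (p := p) (algebraMap S.K 𝕂 : S.K →+* 𝕂) hX0 hXint
  rw [← S.h_eq_finrank] at hmain
  change (S.Ch * max 1 (house ((S.D : S.K) ^ e * S.G L c m l)) ^ S.h)⁻¹ ≤ _ at hmain
  -- compare
  have hnormX : ‖(algebraMap S.K 𝕂 : S.K →+* 𝕂) ((S.D : S.K) ^ e * S.G L c m l)‖ ≤
      ‖algebraMap S.K 𝕂 (S.G L c m l)‖ := by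
    rw [map_mul, map_pow, norm_mul, norm_pow]
    have hD : ‖(algebraMap S.K 𝕂 : S.K →+* 𝕂) (S.D : S.K)‖ ≤ 1 := by
      rw [map_intCast]; exact S.norm_D_le_one
    exact mul_le_of_le_one_left (norm_nonneg _) (pow_le_one₀ (norm_nonneg _) hD)
  have hCh1 := S.one_le_Ch
  refine le_trans ?_ (hmain.trans hnormX)
  refine inv_anti₀ (by positivity) ?_
  refine mul_le_mul_of_nonneg_left ?_ (by linarith)
  exact pow_le_pow_left₀ (by positivity) (max_le_max_left 1 hhouse) _

/-! ### Lemma 2: the coefficients `c(λ)` from Siegel's lemma -/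

section Siegel

variable (L : ℕ) (P₀ D₀ : ℕ)

omit [IsUltrametricDist 𝕂] in
/-- The uniform denominator exponent `e₀ = n D₀ + (n+1) L P₀ ≥ e` used for all equations of the
Siegel system. [cite: BakerTNT1975, Ch. 2 Lemma 2, eq. (6)] -/
def e₀ : ℕ := S.n * D₀ + (S.n + 1) * (L * P₀)

omit [IsUltrametricDist 𝕂] in
/-- `e ≤ e₀` on the relevant range. [folklore] -/
theorem eD_le_e₀ {m : Fin S.n → ℕ} (hm : ∀ r, m r ≤ D₀) {l : ℕ} (hl : l ≤ P₀) :
    eD S.n L m l ≤ S.e₀ L P₀ D₀ := by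
  unfold eD e₀
  have h1 : ∑ r, m r ≤ S.n * D₀ :=
    (sum_le_sum fun r _ => hm r).trans (by simp)
  have h2 : (S.n + 1) * (L * l) ≤ (S.n + 1) * (L * P₀) :=
    Nat.mul_le_mul_left _ (Nat.mul_le_mul_left _ hl)
  omega

omit [IsUltrametricDist 𝕂] in
/-- The algebraic integers `X(λ; l, m) = D^{e₀} termK` whose integer coordinates are the
coefficients of the Siegel system (Baker's `A(s,t)`-equations, p. 21, with the spanning family
`α^s β^t` replaced by an integral basis of `K`). [cite: BakerTNT1975, Ch. 2 Lemma 2] -/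
def XO (u : Idx S.n L) (m : Fin S.n → Fin (D₀ + 1)) (l : Fin P₀) : 𝓞 S.K :=
  ⟨(S.D : S.K) ^ S.e₀ L P₀ D₀ * S.termK L u (fun r => (m r : ℕ)) ((l : ℕ) + 1), by
    have hle : eD S.n L (fun r => (m r : ℕ)) ((l : ℕ) + 1) ≤ S.e₀ L P₀ D₀ :=
      S.eD_le_e₀ L P₀ D₀ (fun r => Nat.lt_succ_iff.mp (m r).isLt) l.isLt
    rw [← Nat.sub_add_cancel hle, pow_add, mul_assoc]
    exact ((S.isIntegral_intCast_K _).pow _).mul (S.isIntegral_D_pow_mul_termK u _ _)⟩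

omit [IsUltrametricDist 𝕂] in
/-- The integer matrix of the Siegel system: rows `(l, m, i)` (`i` an integral-basis coordinate),
columns `λ`, entries `coordᵢ X(λ; l, m)`. [cite: BakerTNT1975, Ch. 2 Lemma 2] -/
def sMat : Matrix (Fin P₀ × (Fin S.n → Fin (D₀ + 1)) × (S.K →+* ℂ)) (Idx S.n L) ℤ :=
  Matrix.of fun ρ u => S.bO.repr (S.XO L P₀ D₀ u ρ.2.1 ρ.1) ρ.2.2

variable [CompleteSpace 𝕂]

/-- **Baker 1975, Ch. 2, Lemma 2** (p. 21), `p`-adic set-up, general parameters: if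
`(L+1)^{n+1} ≥ 2 · P₀ (D₀+1)ⁿ h` then there are integers `c(λ)`, `λ ∈ [0,L]^{n+1}`, not all zero,
with `|c(λ)| ≤ (L+1)^{n+1} c_K |D|^{e₀} (2LM)^{n D₀} M^{(n+1)LP₀}` (the source: `≤ e^{h²}` for its
parameters), such that `F c m (l p) = 0` for all integers `1 ≤ l ≤ P₀` and all `m` with every
`mᵣ ≤ D₀`.  Proof as in the source: the vanishing is implied by integer linear equations
(coordinates of `D^{e₀} G` in an integral basis), solved by Siegel's lemma (Mathlib's
`Int.Matrix.exists_ne_zero_int_vec_norm_le`). [cite: BakerTNT1975, Ch. 2 Lemma 2] -/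
theorem lemma2 (hP : 0 < P₀)
    (hcard : 2 * (P₀ * (D₀ + 1) ^ S.n * S.h) ≤ (L + 1) ^ (S.n + 1)) :
    ∃ c : Idx S.n L → ℤ, c ≠ 0 ∧
      (∀ u, |(c u : ℝ)| ≤ ((L + 1 : ℕ) : ℝ) ^ (S.n + 1) * (S.cK * (|(S.D : ℝ)| ^ S.e₀ L P₀ D₀ *
        ((2 * L * S.M) ^ (S.n * D₀) * S.M ^ ((S.n + 1) * (L * P₀)))))) ∧
      ∀ l : ℕ, 1 ≤ l → l ≤ P₀ → ∀ m : Fin S.n → ℕ, (∀ r, m r ≤ D₀) →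
        S.F c m ((l : 𝕂) * p) = 0 := by
  classical
  letI : SeminormedAddCommGroup
      (Matrix (Fin P₀ × (Fin S.n → Fin (D₀ + 1)) × (S.K →+* ℂ)) (Idx S.n L) ℤ) :=
    Matrix.seminormedAddCommGroup
  set A := S.sMat L P₀ D₀ with hA
  have hM1 := S.one_le_M
  have hcK := S.one_le_cK
  have hD1 := S.one_le_abs_D
  have hh := S.one_le_h
  -- cardinalities
  have hrows : Fintype.card (Fin P₀ × (Fin S.n → Fin (D₀ + 1)) × (S.K →+* ℂ)) =
      P₀ * (D₀ + 1) ^ S.n * S.h := by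
    simp only [Fintype.card_prod, Fintype.card_fun, Fintype.card_fin, h]
    ring
  have hcols : Fintype.card (Idx S.n L) = (L + 1) ^ (S.n + 1) := card_Idx _ _
  have hrowpos : 0 < P₀ * (D₀ + 1) ^ S.n * S.h := by positivity
  have hL1 : 1 ≤ L := by
    rcases Nat.eq_zero_or_pos L with h0 | h0
    · subst h0; simp at hcard; omega
    · exact h0
  obtain ⟨t, ht0, hAt, hnorm⟩ := Int.Matrix.exists_ne_zero_int_vec_norm_le A
    (by rw [hrows, hcols]; omega) (by rw [hrows]; exact hrowpos)
  rw [hrows, hcols] at hnorm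
  -- the entry bound
  set U : ℝ := S.cK * (|(S.D : ℝ)| ^ S.e₀ L P₀ D₀ *
    ((2 * L * S.M) ^ (S.n * D₀) * S.M ^ ((S.n + 1) * (L * P₀)))) with hU
  have hLM1 : (1 : ℝ) ≤ 2 * L * S.M := by
    have : (1 : ℝ) ≤ L := by exact_mod_cast hL1
    nlinarith
  have hU1 : 1 ≤ U := by
    have h1 : (1 : ℝ) ≤ |(S.D : ℝ)| ^ S.e₀ L P₀ D₀ := one_le_pow₀ hD1
    have h2 : (1 : ℝ) ≤ (2 * L * S.M) ^ (S.n * D₀) := one_le_pow₀ hLM1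
    have h4 : (1 : ℝ) ≤ S.M ^ ((S.n + 1) * (L * P₀)) := one_le_pow₀ hM1
    rw [hU]
    calc (1 : ℝ) = 1 * (1 * (1 * 1)) := by ring
      _ ≤ S.cK * (|(S.D : ℝ)| ^ S.e₀ L P₀ D₀ *
          ((2 * L * S.M) ^ (S.n * D₀) * S.M ^ ((S.n + 1) * (L * P₀)))) := by
          gcongr
  have hentry : ∀ ρ u, |(A ρ u : ℝ)| ≤ U := by
    rintro ⟨l, m, i⟩ u
    have hb := S.abs_repr_le (S.XO L P₀ D₀ u m l) i
    simp only [hA, sMat, Matrix.of_apply]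
    refine hb.trans ?_
    rw [hU]
    refine mul_le_mul_of_nonneg_left ?_ (by linarith)
    have hX : (algebraMap (𝓞 S.K) S.K (S.XO L P₀ D₀ u m l)) =
        (S.D : S.K) ^ S.e₀ L P₀ D₀ * S.termK L u (fun r => (m r : ℕ)) ((l : ℕ) + 1) := rfl
    rw [hX]
    refine (S.house_D_pow_mul_termK_le _ u _ _).trans ?_
    refine mul_le_mul_of_nonneg_left ?_ (by positivity)
    have hM0 : (0 : ℝ) < S.M := by linarith
    have e1 : (2 * L * S.M) ^ (∑ r, ((m r : ℕ))) ≤ (2 * L * S.M) ^ (S.n * D₀) := by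
      refine pow_le_pow_right₀ hLM1 ?_
      exact (sum_le_sum fun r _ => Nat.lt_succ_iff.mp (m r).isLt).trans (by simp)
    have e3 : S.M ^ ((S.n + 1) * (L * ((l : ℕ) + 1))) ≤ S.M ^ ((S.n + 1) * (L * P₀)) := by
      refine pow_le_pow_right₀ hM1 (Nat.mul_le_mul_left _ (Nat.mul_le_mul_left _ ?_))
      exact l.isLt
    exact mul_le_mul e1 e3 (by positivity) (by positivity)
  have hAnorm : ‖A‖ ≤ U := by
    rw [Matrix.norm_le_iff (by linarith)]
    intro ρ u
    rw [Int.norm_eq_abs]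
    exact_mod_cast hentry ρ u
  -- the bound for `t`
  have hcols1 : (1 : ℝ) ≤ (((L + 1) ^ (S.n + 1) : ℕ) : ℝ) := by
    exact_mod_cast Nat.one_le_pow _ _ (Nat.succ_pos L)
  have hbase1 : (1 : ℝ) ≤ (((L + 1) ^ (S.n + 1) : ℕ) : ℝ) * max 1 ‖A‖ :=
    one_le_mul_of_one_le_of_one_le hcols1 (le_max_left _ _)
  have hexp : ((P₀ * (D₀ + 1) ^ S.n * S.h : ℕ) : ℝ) /
      ((((L + 1) ^ (S.n + 1) : ℕ) : ℝ) - ((P₀ * (D₀ + 1) ^ S.n * S.h : ℕ) : ℝ)) ≤ 1 := by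
    have h2 : (2 : ℝ) * ((P₀ * (D₀ + 1) ^ S.n * S.h : ℕ) : ℝ) ≤
        (((L + 1) ^ (S.n + 1) : ℕ) : ℝ) := by exact_mod_cast hcard
    have hpos : (0 : ℝ) < ((P₀ * (D₀ + 1) ^ S.n * S.h : ℕ) : ℝ) := by exact_mod_cast hrowpos
    rw [div_le_one (by linarith)]
    linarith
  have htu : ∀ u, |(t u : ℝ)| ≤ (((L + 1) ^ (S.n + 1) : ℕ) : ℝ) * U := by
    intro u
    calc |(t u : ℝ)| = ‖t u‖ := (Int.norm_eq_abs _).symm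
      _ ≤ ‖t‖ := norm_le_pi_norm t u
      _ ≤ _ := hnorm
      _ ≤ ((((L + 1) ^ (S.n + 1) : ℕ) : ℝ) * max 1 ‖A‖) ^ (1 : ℝ) :=
          Real.rpow_le_rpow_of_exponent_le hbase1 hexp
      _ = (((L + 1) ^ (S.n + 1) : ℕ) : ℝ) * max 1 ‖A‖ := Real.rpow_one _
      _ ≤ (((L + 1) ^ (S.n + 1) : ℕ) : ℝ) * U :=
          mul_le_mul_of_nonneg_left (max_le hU1 hAnorm) (by positivity)
  refine ⟨t, ht0, fun u => ?_, ?_⟩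
  · have := htu u
    push_cast at this ⊢
    exact this
  -- the vanishing
  intro l hl1 hlP m hm
  set ρl : Fin P₀ := ⟨l - 1, by omega⟩ with hρl
  set ρm : Fin S.n → Fin (D₀ + 1) := fun r => ⟨m r, Nat.lt_succ_iff.mpr (hm r)⟩ with hρm
  have hml : (fun r => ((ρm r : Fin (D₀ + 1)) : ℕ)) = m := by funext r; rfl
  have hll : (ρl : ℕ) + 1 = l := by simp [hρl]; omega
  -- the combination `∑ t(λ) X(λ)` vanishes in `𝓞 K`
  have hcomb : ∑ u, (t u : 𝓞 S.K) * S.XO L P₀ D₀ u ρm ρl = 0 := by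
    apply S.bO.repr.injective
    rw [map_zero]
    ext i
    have hi := congrFun hAt (ρl, ρm, i)
    simp only [Matrix.mulVec, dotProduct, Pi.zero_apply, hA, sMat, Matrix.of_apply] at hi
    rw [map_sum, Finsupp.coe_finsetSum, Finset.sum_apply, Finsupp.coe_zero, Pi.zero_apply, ← hi]
    refine sum_congr rfl fun u _ => ?_
    rw [← zsmul_eq_mul, LinearEquiv.map_smul, Finsupp.coe_smul, Pi.smul_apply, smul_eq_mul,
      mul_comm]
  -- hence in `𝕂`
  have hcombK : (S.D : 𝕂) ^ S.e₀ L P₀ D₀ * algebraMap S.K 𝕂 (S.G L t m l) = 0 := by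
    have h1 := congrArg (fun x : 𝓞 S.K => algebraMap S.K 𝕂 (algebraMap (𝓞 S.K) S.K x)) hcomb
    simp only [map_sum, map_mul, map_zero] at h1
    rw [G, map_sum, mul_sum, ← h1]
    refine sum_congr rfl fun u _ => ?_
    have e1 : algebraMap (𝓞 S.K) S.K (S.XO L P₀ D₀ u ρm ρl) =
        (S.D : S.K) ^ S.e₀ L P₀ D₀ * S.termK L u m l := by
      rw [← hml, ← hll]; rfl
    have e2 : algebraMap (𝓞 S.K) S.K (t u : 𝓞 S.K) = (t u : S.K) := map_intCast _ _
    rw [e1, e2, map_mul, map_mul, map_pow, map_intCast, map_intCast]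
    ring
  have hG0 : algebraMap S.K 𝕂 (S.G L t m l) = 0 := by
    rcases mul_eq_zero.mp hcombK with h0 | h0
    · exact absurd (pow_eq_zero_iff'.mp h0).1 (by exact_mod_cast S.D_ne_zero)
    · exact h0
  rw [S.F_natMul_eq, hG0, mul_zero]

end Siegel

end Setup

end BrumerPadic

end Literature.NumberTheory.Transcendental

end
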